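import Summits.HodgeConjecture.HodgeConjecture.Theorems.A3Liu413ArithmeticIndex
import Literature.GroupTheory.ClassSetMass
import HarnessLib

/-!
# `h413` stub (b), level-form assembly (b6) — the class weights in the currency of the levels of the tower

Support file for the crux `H413` (stmt-HodgeConjecture-24833), line `a3-liu413`, stub `stub_unitarizableAtPin` (A-p10 SPEC-b6-Assembly-v2, file F1b).
KERNEL ONLY (theorems).  The weight calculus of `Literature.GroupTheory.ClassSetMass` instantiated at `G := U(V)(𝔸_{L₀,f})`, `U := (ρ V).range = U(V)(L₀)`,
reference level `Δ₀`, family `𝒞 :=` open compact subgroups (hypotheses discharged by `A3Liu413ArithmeticIndex`):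
* `classWeight_level_pos` (W0), `classWeight_level_mul_of_mem` / `classWeight_level_rel` / `classWeight_level_eq_of_mk_eq` (W1: class invariance, input (III)
  `relIndex_map_conj_range_inf_eq`, `[L:ℚ] ≠ 2`), `sum_fibre_classWeight_level` (W2: refinement `Γ' ≤ Γ`),
* **`classWeight_level_conj`** (W3 with the modular ratio ELIMINATED by the mass trick `modularRatio_eq_one`): the weight of the index `y` at the translated
  level `Γ.conj g` is the weight of `y g` at `Γ` — this is what makes the weighted level forms honestly `U(V)(𝔸_f)`-invariant;
* `sum_classSet_translate` — re-indexing a class sum along `y ↦ y g` between the class sets of `Γ.conj g` and `Γ`.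
HC_CM is proved only modulo the printed citations until rung 0 closes; this file discharges nothing of them.
-/

noncomputable section

open scoped Pointwise
open NumberField IsDedekindDomain
open Literature.AlgebraicGeometry.ShimuraVarieties
open Literature.NumberTheory.Automorphic
open Literature.GroupTheory
open HodgeCM.Adelic HodgeCM.PerL34.AdelicUnitaryFactorisation HodgeCM.PerL34.Godement

namespace HodgeCM

open HodgeCM.Model.LevelTranslate

namespace Model.TowerLevel

variable {L : CMField} {ι₁ : L →+* ℂ} (V : HermSpace3 L ι₁)

/-! ## §0 The family of open compact subgroups of `U(V)(𝔸_{L₀,f})` satisfies the hypotheses of `ClassSetMass` -/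

/-- The open compact subgroups are stable under conjugation. [folklore] -/
theorem openCompact_map_conj :
    ∀ K ∈ {K : Subgroup V.adelicFin | IsCompact (K : Set V.adelicFin) ∧ IsOpen (K : Set V.adelicFin)}, ∀ g : V.adelicFin,
      K.map (MulAut.conj g).toMonoidHom ∈
        {K : Subgroup V.adelicFin | IsCompact (K : Set V.adelicFin) ∧ IsOpen (K : Set V.adelicFin)} :=
  fun _ hK g => isCompact_isOpen_map_conj hK g

/-- The open compact subgroups are pairwise commensurable. [folklore] -/
theorem openCompact_commensurable :
    ∀ K ∈ {K : Subgroup V.adelicFin | IsCompact (K : Set V.adelicFin) ∧ IsOpen (K : Set V.adelicFin)},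
      ∀ K' ∈ {K : Subgroup V.adelicFin | IsCompact (K : Set V.adelicFin) ∧ IsOpen (K : Set V.adelicFin)}, Subgroup.Commensurable K K' :=
  fun _ hK _ hK' => commensurable_of_isCompact_isOpen hK.1 hK.2 hK'.1 hK'.2

/-- The compact open of a level is open compact. [folklore] -/
theorem level_mem_openCompact (Δ : Level V) :
    Δ.K ∈ {K : Subgroup V.adelicFin | IsCompact (K : Set V.adelicFin) ∧ IsOpen (K : Set V.adelicFin)} :=
  ⟨Δ.isCompact_K, Δ.isOpen_K⟩

/-! ## §1 (W0)–(W2) at levels -/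

/-- (W0) The class weights are positive. [cite: ShimuraIATAF1971, §3.1] -/
theorem classWeight_level_pos (Δ₀ Δ : Level V) (y : V.adelicFin) : 0 < classWeight (ρ V).range Δ₀.K Δ.K y :=
  classWeight_pos (openCompact_map_conj V) (openCompact_commensurable V) (level_mem_openCompact V Δ₀) (level_mem_openCompact V Δ) y

/-- (W1) Class invariance `w_Δ(u y k) = w_Δ(y)` for rational `u` and `k ∈ K_Δ` (input (III), `[L:ℚ] ≠ 2`). [cite: ShimuraIATAF1971, §3.3 Prop. 3.6] -/
theorem classWeight_level_mul_of_mem (hL : Module.finrank ℚ L ≠ 2) (Δ₀ Δ : Level V) (y : V.adelicFin) {u k : V.adelicFin}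
    (hu : u ∈ (ρ V).range) (hk : k ∈ Δ.K) :
    classWeight (ρ V).range Δ₀.K Δ.K (u * y * k) = classWeight (ρ V).range Δ₀.K Δ.K y :=
  classWeight_mul_of_mem (openCompact_map_conj V) (openCompact_commensurable V) (level_mem_openCompact V Δ₀)
    (fun _ hu' => relIndex_map_conj_range_inf_eq V hL Δ₀ hu') (level_mem_openCompact V Δ) y hu hk

/-- (W1) along the family relation `Rel Γ γ y y'` (`y' = (γ)_f y k`). [cite: ShimuraIATAF1971, §3.3 Prop. 3.6] -/
theorem classWeight_level_rel (hL : Module.finrank ℚ L ≠ 2) (Δ₀ : Level V) {Γ : Level V} {γ : ↥(Urat V)} {y y' : V.adelicFin}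
    (r : Rel Γ γ y y') : classWeight (ρ V).range Δ₀.K Γ.K y' = classWeight (ρ V).range Δ₀.K Γ.K y := by
  obtain ⟨k, hk, rfl⟩ := r
  exact classWeight_level_mul_of_mem V hL Δ₀ Γ y ⟨γ, rfl⟩ hk

/-- (W1) for two representatives of the same class of `U(V)(L₀)\U(V)(𝔸_f)/K_Γ`. [cite: ShimuraIATAF1971, §3.3 Prop. 3.6] -/
theorem classWeight_level_eq_of_mk_eq (hL : Module.finrank ℚ L ≠ 2) (Δ₀ Γ : Level V) {y y' : V.adelicFin}
    (h : DoubleCoset.mk (ρ V).range Γ.K y = DoubleCoset.mk (ρ V).range Γ.K y') :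
    classWeight (ρ V).range Δ₀.K Γ.K y' = classWeight (ρ V).range Δ₀.K Γ.K y := by
  obtain ⟨u, hu, k, hk, rfl⟩ := (DoubleCoset.eq _ _ y y').mp h
  exact classWeight_level_mul_of_mem V hL Δ₀ Γ y hu hk

/-- (W2) Refinement: for `Γ' ≤ Γ`, summing the `Γ'`-weights over the `(U, K_{Γ'})`-classes inside `U x K_Γ` gives the `Γ`-weight of `x`.
[cite: ShimuraIATAF1971, §3.1 Prop. 3.1 and §3.3] -/
theorem sum_fibre_classWeight_level (hL : Module.finrank ℚ L ≠ 2) (Δ₀ : Level V) {Γ Γ' : Level V} (hle : Γ' ≤ Γ) (x : V.adelicFin)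
    [Fintype (DoubleCoset.Quotient (((ρ V).range : Subgroup V.adelicFin) : Set V.adelicFin) (Γ'.K : Set V.adelicFin))]
    [DecidableEq (DoubleCoset.Quotient (((ρ V).range : Subgroup V.adelicFin) : Set V.adelicFin) (Γ.K : Set V.adelicFin))] :
    ∑ q' ∈ Finset.univ.filter
        (fun q' : DoubleCoset.Quotient (((ρ V).range : Subgroup V.adelicFin) : Set V.adelicFin) (Γ'.K : Set V.adelicFin) =>
          DoubleCoset.mk (ρ V).range Γ.K q'.out = DoubleCoset.mk (ρ V).range Γ.K x),
      classWeight (ρ V).range Δ₀.K Γ'.K q'.out = classWeight (ρ V).range Δ₀.K Γ.K x := by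
  haveI : Γ'.K.IsFiniteRelIndex Γ.K := ⟨relIndex_ne_zero_of_isCompact_isOpen Γ.isCompact_K Γ'.isOpen_K⟩
  exact sum_fibre_classWeight (openCompact_map_conj V) (openCompact_commensurable V) (level_mem_openCompact V Δ₀)
    (fun _ hu' => relIndex_map_conj_range_inf_eq V hL Δ₀ hu') (level_mem_openCompact V Γ) (level_mem_openCompact V Γ')
    (Level.le_def.mp hle) x

/-! ## §2 (W3) at levels, with the modular ratio eliminated -/

/-- **(W3) at levels, honestly**: `w_{Γ.conj g}(y) = w_Γ(y g)` — the weight of the index `y` at the translated level `gK_Γg⁻¹` is the weight of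
`y g` at `K_Γ`.  (`ClassSetMass.classWeight_map_conj` gives the factor `modularRatio K_{Δ₀} g`, which is `1` by the MASS TRICK
`modularRatio_eq_one` applied to the open compact `K_Γ`, its conjugate and their intersection — all with finite class sets when `[L:ℚ] ≠ 2`.)
[cite: ShimuraIATAF1971, §3.3 Prop. 3.6] [cite: PlatonovRapinchuk1994, §8.1] -/
theorem classWeight_level_conj (hL : Module.finrank ℚ L ≠ 2) (Δ₀ Γ : Level V) (hΓ : Γ.BelowConjThree) (g y : V.adelicFin) :
    classWeight (ρ V).range Δ₀.K (Γ.conj g hΓ).K y = classWeight (ρ V).range Δ₀.K Γ.K (y * g) := by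
  classical
  have hKo := Γ.isOpen_K
  have hKc := Γ.isCompact_K
  have hgK := isCompact_isOpen_map_conj ⟨hKc, hKo⟩ g
  have hio : IsOpen (((Γ.K ⊓ Γ.K.map (MulAut.conj g).toMonoidHom : Subgroup V.adelicFin)) : Set V.adelicFin) := hKo.inter hgK.2
  have hic : IsCompact (((Γ.K ⊓ Γ.K.map (MulAut.conj g).toMonoidHom : Subgroup V.adelicFin)) : Set V.adelicFin) :=
    hKc.of_isClosed_subset (Subgroup.isClosed_of_isOpen _ hio) Set.inter_subset_left
  haveI := HermSpace3.finite_doubleCoset_range_ρ V hL Γ.K hKo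
  haveI := HermSpace3.finite_doubleCoset_range_ρ V hL _ hgK.2
  haveI := HermSpace3.finite_doubleCoset_range_ρ V hL _ hio
  letI : Fintype (DoubleCoset.Quotient (((ρ V).range : Subgroup V.adelicFin) : Set V.adelicFin) (Γ.K : Set V.adelicFin)) :=
    Fintype.ofFinite _
  letI : Fintype (DoubleCoset.Quotient (((ρ V).range : Subgroup V.adelicFin) : Set V.adelicFin)
      ((Γ.K.map (MulAut.conj g).toMonoidHom : Subgroup V.adelicFin) : Set V.adelicFin)) := Fintype.ofFinite _
  letI : Fintype (DoubleCoset.Quotient (((ρ V).range : Subgroup V.adelicFin) : Set V.adelicFin)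
      ((Γ.K ⊓ Γ.K.map (MulAut.conj g).toMonoidHom : Subgroup V.adelicFin) : Set V.adelicFin)) := Fintype.ofFinite _
  haveI : (Γ.K ⊓ Γ.K.map (MulAut.conj g).toMonoidHom).IsFiniteRelIndex Γ.K :=
    ⟨relIndex_ne_zero_of_isCompact_isOpen hKc hio⟩
  haveI : (Γ.K ⊓ Γ.K.map (MulAut.conj g).toMonoidHom).IsFiniteRelIndex (Γ.K.map (MulAut.conj g).toMonoidHom) :=
    ⟨relIndex_ne_zero_of_isCompact_isOpen hgK.1 hio⟩
  show classWeight (ρ V).range Δ₀.K (Γ.K.map (MulAut.conj g).toMonoidHom) y = _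
  rw [classWeight_map_conj (openCompact_map_conj V) (openCompact_commensurable V) (level_mem_openCompact V Δ₀)
      (level_mem_openCompact V Γ) g y,
    modularRatio_eq_one (openCompact_map_conj V) (openCompact_commensurable V) (level_mem_openCompact V Δ₀)
      (fun _ hu' => relIndex_map_conj_range_inf_eq V hL Δ₀ hu') (level_mem_openCompact V Γ) g ⟨hic, hio⟩,
    one_mul]

/-! ## §3 Re-indexing a class sum along a translate -/

/-- **Re-indexing along `y ↦ y g`**: for a class function `F` of level `Γ` (`F (u y k) = F y`, `u` rational, `k ∈ K_Γ`),
`Σ_{q ∈ U\G/K_{Γ.conj g}} F (q.out · g) = Σ_{q ∈ U\G/K_Γ} F q.out`. [cite: PlatonovRapinchuk1994, §8.1] -/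
theorem sum_classSet_translate {M : Type*} [AddCommMonoid M] (Γ : Level V) (hΓ : Γ.BelowConjThree) (g : V.adelicFin)
    [Fintype (DoubleCoset.Quotient (((ρ V).range : Subgroup V.adelicFin) : Set V.adelicFin) (Γ.K : Set V.adelicFin))]
    [i2 : Fintype (DoubleCoset.Quotient (((ρ V).range : Subgroup V.adelicFin) : Set V.adelicFin) ((Γ.conj g hΓ).K : Set V.adelicFin))]
    (F : V.adelicFin → M) (hF : ∀ (y : V.adelicFin), ∀ u ∈ (ρ V).range, ∀ k ∈ Γ.K, F (u * y * k) = F y) :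
    ∑ q : DoubleCoset.Quotient (((ρ V).range : Subgroup V.adelicFin) : Set V.adelicFin) ((Γ.conj g hΓ).K : Set V.adelicFin),
        F (q.out * g) =
      ∑ q : DoubleCoset.Quotient (((ρ V).range : Subgroup V.adelicFin) : Set V.adelicFin) (Γ.K : Set V.adelicFin), F q.out := by
  letI : Fintype (DoubleCoset.Quotient (((ρ V).range : Subgroup V.adelicFin) : Set V.adelicFin)
      ((Γ.K.map (MulAut.conj g).toMonoidHom : Subgroup V.adelicFin) : Set V.adelicFin)) := i2
  exact sum_quotient_map_conj_eq (ρ V).range Γ.K g F hF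

end Model.TowerLevel

end HodgeCM

end
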